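import Summits.QuantumFields.BalabanUV.T4Continuum.Spine.NE9.DirectPairingMarginChannel
import Literature.Analysis.Complex.LocalCrossTheorem

/-!
# T⁴ programme, spine estimate NE9 — THE SLACK IS LOAD-BEARING: a functional HOLOMORPHIC and BOUNDED on the (open) convergence ball need NOT be
# uniformly continuous on it — with ZERO slack between the class and the convergence radius the run-uniform [UC-OLD] clause can fail even for ONE
# run; census C37b's `slack_iff` made two-sided by a witness — census item C37f of cell `pub-balaban-gaps`, seat ne9 (gen 9)

Cell `pub-balaban-gaps` (YM blitz G2, seat ne9, unit `pub-balaban-gaps-ne9-g9`; record `run/shared/lean/pub/pub-balaban-gaps/ne/NE9.md` §5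
row C37f).  Summits-side bookkeeping; one-variable complex analysis on a WITNESS; NO definition; nothing of Bałaban's asserted.

CONTEXT.  `DirectPairingMarginChannel` (C37b) read C37's margin off [Balaban1988RG2Cluster] §§1–2: the class of old activities (radius `E₀`) is
mapped by the linear potentials (norm `C_T`, (1.36)) into the ball of radius `R` on which the polymer series (2.13) converges, and (AN-OLD)+margin
holds as soon as there is SLACK `C_T·E₀ < R` (`slack_iff`); print fixes the slack (p. 21: *"O(1)C₃ε₁ ≤ ½E₀ … (1.1.18), with ½E₀ instead of E₀"*).
This file shows the slack is not a convenience: on the convergence ball ITSELF (slack `0`) a holomorphic functional bounded by `1` can fail to be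
uniformly continuous, so no modulus — let alone a run-uniform one — is available for [UC-OLD] without it.

THE WITNESS.  On the open unit disc `𝔻` (convergence radius `R = 1`, class = `𝔻`, `T = id`, `C_T = 1`, slack `0`) the function
`G(z) = exp(−(1 + z)∕(1 − z))` (the singular inner function): `Re((1 + z)∕(1 − z)) > 0` on `𝔻` (tree's `Literature.Analysis.Complex.cayleyInv_re_pos`), hence
`innerG_bound` — `‖G z‖ ≤ 1` on `𝔻`; `innerG_holo` — `G` is holomorphic on `𝔻`; yet `innerG_not_uniformlyContinuous` — for every `δ > 0` there are
points `w(Y) = iY∕(2 + iY)`, `w(Y + π)` of `𝔻` (on the horocycle `Re((1+z)∕(1−z)) = 1`, where `G(w(y)) = e^{−1−iy}`), `δ`-close for `Y ≥ 4∕δ`, whose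
values are `2∕e` apart.  So {holomorphic on the convergence ball, bounded there} ⇏ uniformly continuous on a class that FILLS the ball: the
inequality `C_T·E₀ < R` of `slack_iff` is exactly what separates C37b's positive theorem from this failure.

HONEST FRAMING: a witness about hypothesis SHAPES; nothing of Bałaban's asserted (print HAS the slack, p. 21); NE9 NOT PRINTED ∕ NOT PROVED; spine
0∕9; instance 0∕1; NOT continuum ∕ ℝ⁴ ∕ mass gap ∕ Clay.  CLASSIFICATION OF NE9 UNCHANGED: WORK-bound (W1).

References (TYPES only): [Balaban1988RG2Cluster] = T. Bałaban, Commun. Math. Phys. **116** (1988) 1–22, (1.36) p. 9, (2.13) p. 14, p. 21;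
[King1986] = C. King, Commun. Math. Phys. **102** (1986) 649–677, §3.2.
-/

namespace Summit.QuantumFields.BalabanUV.T4Continuum.NE9.DirectPairingMarginSlack

open Metric Set Complex

/-! ## §1 The singular inner function on the unit disc: holomorphic, bounded by one -/

/- `1 − z ≠ 0` and `Re((1 + z)∕(1 − z)) > 0` on the unit disc are the tree's `Literature.Analysis.Complex.one_sub_ne_zero_of_norm_lt_one`
(`ConformalRadiusBoundary`) and `cayleyInv_re_pos` (`LocalCrossTheorem`), imported BY NAME. -/

/-- `G(z) = exp(−(1 + z)∕(1 − z))` is bounded by `1` on the unit disc. [folklore] -/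
theorem innerG_bound : ∀ z ∈ ball (0 : ℂ) 1, ‖Complex.exp (-((1 + z) / (1 - z)))‖ ≤ 1 := by
  intro z hz
  rw [mem_ball, dist_zero_right] at hz
  rw [norm_exp, neg_re, Real.exp_le_one_iff]
  linarith [Literature.Analysis.Complex.cayleyInv_re_pos hz]

/-- `G` is holomorphic on the unit disc (the convergence ball of the model). [folklore] -/
theorem innerG_holo : DifferentiableOn ℂ (fun z : ℂ => Complex.exp (-((1 + z) / (1 - z)))) (ball (0 : ℂ) 1) := by
  intro z hz
  rw [mem_ball, dist_zero_right] at hz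
  have hne := Literature.Analysis.Complex.one_sub_ne_zero_of_norm_lt_one hz
  have h1 : DifferentiableAt ℂ (fun z : ℂ => (1 + z) / (1 - z)) z :=
    ((differentiableAt_const _).add differentiableAt_id).div ((differentiableAt_const _).sub differentiableAt_id) hne
  exact (h1.neg.cexp).differentiableWithinAt

/-! ## §2 … and NOT uniformly continuous on the disc: the horocycle points `w(y) = iy∕(2 + iy)` -/

/-- `2 + iy ≠ 0`. [folklore] -/
theorem two_add_ne_zero (y : ℝ) : (2 : ℂ) + I * y ≠ 0 := by
  intro h
  have := congrArg Complex.re h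
  simp at this

/-- The horocycle points lie in the unit disc: `|iy∕(2 + iy)|² = y²∕(4 + y²) < 1`. [folklore] -/
theorem horo_mem_ball (y : ℝ) : I * y / (2 + I * y) ∈ ball (0 : ℂ) 1 := by
  rw [mem_ball, dist_zero_right, norm_div, div_lt_one (norm_pos_iff.2 (two_add_ne_zero y))]
  have h1 : ‖I * (y : ℂ)‖ = |y| := by rw [norm_mul, norm_I, one_mul, norm_real, Real.norm_eq_abs]
  have h2 : ‖(2 : ℂ) + I * y‖ ^ 2 = 4 + y ^ 2 := by
    rw [Complex.sq_norm, normSq_apply]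
    simp
    ring
  have h3 : |y| ^ 2 < ‖(2 : ℂ) + I * y‖ ^ 2 := by rw [h2, sq_abs]; linarith
  rw [h1]
  exact lt_of_pow_lt_pow_left₀ 2 (norm_nonneg _) h3

/-- On the horocycle the Cayley map is `1 + iy`: `(1 + w(y))∕(1 − w(y)) = 1 + iy`. [folklore] -/
theorem cayley_horo (y : ℝ) : (1 + I * y / (2 + I * y)) / (1 - I * y / (2 + I * y)) = 1 + I * y := by
  have hne := two_add_ne_zero y
  have h2 : (1 : ℂ) - I * y / (2 + I * y) = 2 / (2 + I * y) := by
    field_simp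
    ring
  have h1 : (1 : ℂ) + I * y / (2 + I * y) = (2 + 2 * I * y) / (2 + I * y) := by
    field_simp
    ring
  rw [h1, h2, div_div_div_cancel_right₀ hne]
  field_simp

/-- Hence `G(w(y)) = e^{−1−iy}`, of norm `e^{−1}`. [folklore] -/
theorem innerG_horo (y : ℝ) :
    Complex.exp (-((1 + I * y / (2 + I * y)) / (1 - I * y / (2 + I * y)))) = Complex.exp (-1 - I * y) := by
  rw [cayley_horo, neg_add']

/-- Consecutive horocycle points `w(Y)`, `w(Y + π)` are `4∕Y`-close (`w(y) = 1 − 2∕(2 + iy)` and `|2 + iy| ≥ y`). [folklore] -/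
theorem horo_close {Y : ℝ} (hY : 0 < Y) :
    ‖I * Y / (2 + I * Y) - I * ((Y + Real.pi : ℝ) : ℂ) / (2 + I * ((Y + Real.pi : ℝ) : ℂ))‖ ≤ 4 / Y := by
  have hπ := Real.pi_pos
  have key : ∀ y : ℝ, 0 < y → ‖(1 : ℂ) - I * y / (2 + I * y)‖ ≤ 2 / y := by
    intro y hy
    have hne := two_add_ne_zero y
    have h : (1 : ℂ) - I * y / (2 + I * y) = 2 / (2 + I * y) := by field_simp; ring
    rw [h, norm_div, RCLike.norm_ofNat]
    apply div_le_div_of_nonneg_left (by norm_num) hy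
    calc (y : ℝ) = |((2 : ℂ) + I * y).im| := by simp [abs_of_pos hy]
      _ ≤ ‖(2 : ℂ) + I * y‖ := abs_im_le_norm _
  have e : I * Y / (2 + I * Y) - I * ((Y + Real.pi : ℝ) : ℂ) / (2 + I * ((Y + Real.pi : ℝ) : ℂ)) =
      ((1 : ℂ) - I * ((Y + Real.pi : ℝ) : ℂ) / (2 + I * ((Y + Real.pi : ℝ) : ℂ))) - ((1 : ℂ) - I * Y / (2 + I * Y)) := by ring
  rw [e]
  calc ‖((1 : ℂ) - I * ((Y + Real.pi : ℝ) : ℂ) / (2 + I * ((Y + Real.pi : ℝ) : ℂ))) - ((1 : ℂ) - I * Y / (2 + I * Y))‖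
      ≤ ‖(1 : ℂ) - I * ((Y + Real.pi : ℝ) : ℂ) / (2 + I * ((Y + Real.pi : ℝ) : ℂ))‖ + ‖(1 : ℂ) - I * Y / (2 + I * Y)‖ := norm_sub_le _ _
    _ ≤ 2 / (Y + Real.pi) + 2 / Y := add_le_add (key _ (by linarith)) (key _ hY)
    _ ≤ 2 / Y + 2 / Y := by gcongr; linarith
    _ = 4 / Y := by ring

/-- … while their values are `2∕e` apart: `e^{−1−iY} − e^{−1−i(Y+π)} = 2e^{−1−iY}`. [folklore] -/
theorem innerG_horo_apart (Y : ℝ) :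
    ‖Complex.exp (-1 - I * Y) - Complex.exp (-1 - I * ((Y + Real.pi : ℝ) : ℂ))‖ = 2 * Real.exp (-1) := by
  have h : Complex.exp (-1 - I * ((Y + Real.pi : ℝ) : ℂ)) = - Complex.exp (-1 - I * Y) := by
    rw [show (-1 : ℂ) - I * ((Y + Real.pi : ℝ) : ℂ) = (-1 - I * Y) + (-Real.pi * I) by push_cast; ring, Complex.exp_add,
      show (-(Real.pi : ℂ)) * I = -(Real.pi * I) by ring, Complex.exp_neg, Complex.exp_pi_mul_I]
    ring
  rw [h, sub_neg_eq_add, ← two_mul, norm_mul, RCLike.norm_ofNat, norm_exp]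
  congr 1
  simp

/-- **HOLOMORPHIC AND BOUNDED ON THE CONVERGENCE BALL, NOT UNIFORMLY CONTINUOUS ON IT** (slack `0`): for every `δ > 0` there are points of the
unit disc `δ`-close whose `G`-values are `2∕e > 1∕2` apart.  With `DirectPairingMarginChannel.slack_iff`: the slack `C_T·E₀ < R` is what separates
the linear channel's (AN-OLD)+margin from this failure. [folklore] -/
theorem innerG_not_uniformlyContinuous :
    ¬ (∀ ε : ℝ, 0 < ε → ∃ δ : ℝ, 0 < δ ∧ ∀ z ∈ ball (0 : ℂ) 1, ∀ w ∈ ball (0 : ℂ) 1, ‖z - w‖ ≤ δ →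
        ‖Complex.exp (-((1 + z) / (1 - z))) - Complex.exp (-((1 + w) / (1 - w)))‖ ≤ ε) := by
  intro h
  obtain ⟨δ, hδ, h⟩ := h (1 / 2) (by norm_num)
  set Y : ℝ := 4 / δ with hYdef
  have hY : 0 < Y := by positivity
  have hclose : ‖I * Y / (2 + I * Y) - I * ((Y + Real.pi : ℝ) : ℂ) / (2 + I * ((Y + Real.pi : ℝ) : ℂ))‖ ≤ δ := by
    refine (horo_close hY).trans (le_of_eq ?_)
    rw [hYdef]; field_simp
  have key := h _ (horo_mem_ball Y) _ (horo_mem_ball (Y + Real.pi)) hclose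
  rw [innerG_horo, innerG_horo, innerG_horo_apart] at key
  -- 2/e > 1/2 since e < 4
  have he : Real.exp 1 < 4 := by
    have := Real.exp_one_lt_d9; norm_num at this; linarith
  have hpos : (0 : ℝ) < Real.exp 1 := Real.exp_pos 1
  have h2 : 1 / 2 < 2 * Real.exp (-1) := by
    rw [Real.exp_neg, ← div_eq_mul_inv, lt_div_iff₀ hpos]
    linarith
  linarith

end Summit.QuantumFields.BalabanUV.T4Continuum.NE9.DirectPairingMarginSlack
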